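import Summits.Parity.GeneralizedHardyLittlewood.Theorems.LeeYangFibresAbsoluteUpgradeUniformLocalRatio
import Summits.Parity.GeneralizedHardyLittlewood.Theorems.LeeYangFibresAbsoluteUpgradeUniformCondLocalAverage
import Summits.Parity.GeneralizedHardyLittlewood.Theorems.LeeYangFibresAbsoluteUpgradeUniformTailCollisions
import Summits.Parity.GeneralizedHardyLittlewood.Theorems.LeeYangFibresAbsoluteUpgradeUniformMediumCollisions
import Summits.Parity.GeneralizedHardyLittlewood.Theorems.LeeYangFibresAbsoluteUpgradeUniformSingularMeanGlue
import Summits.Parity.GeneralizedHardyLittlewood.Theorems.LeeYangFibresAbsoluteUpgradeUniformAmplification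
import Summits.Parity.GeneralizedHardyLittlewood.Theorems.LeeYangFibresAbsoluteUpgradeSummit
import HarnessLib

/-!
# Route `LeeYangFibres`, crux `AbsoluteUpgrade` (stmt-Parity-14116), line `Sketch` (uniform amplification):
# door (b) of the strategist census, PROVED — and the m-uniform Gallagher average

Composition BY NAME of the six landed stubs of the reshaped line `Cruxes/AbsoluteUpgrade/Lines/Sketch.lean`
(vocabulary `Theorems/LeeYangFibresAbsoluteUpgradeUniformDefs.lean`):
`stub_localRatioFacts` (A, `…UniformLocalRatio`), `stub_condLocalAverage` (B, `…UniformCondLocalAverage`),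
`stub_collisionFormFactsAndTail` (C ∧ D2, `…UniformCollisionForms`, `…UniformTailCollisions`),
`stub_mediumCollisions` (D1, `…UniformMediumCollisions*`), `stub_uniformSingularMeanGlue` (E,
`…UniformSingularMeanGlue*`), `stub_amplification` (F, `…UniformAmplification*`).  Two UNCONDITIONAL theorems
result:

* `uniformSingularMean` — **Gallagher's singular-series average for translate-constellations, uniform in the
  number of translates** `m + 1 ≤ (log log N)^A / t`: the main terms `β_∞(Ψ^{(H)}, K_H) 𝔖(Ψ^{(H)})` of the
  non-degenerate translate-constellations of a one-dimensional `t`-system `Ψ` sum over the shift box to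
  `(β_∞(Ψ,K) 𝔖(Ψ))^{m+1}` up to `ε((β_∞𝔖)^{m+1} + N^{m+1})`.  (The fixed-`m` statement `SingularMean` of crux
  `RelativeDimOne` is the special case `A = 0`-type bookkeeping; the uniform one needs the averaged treatment of
  the collision primes — exact Chinese-remainder averages with collision conditions for moduli `≤ √N`, Rankin's
  trick beyond.)
* `dimOne_of_uniformRelativeDimOne` — **door (b)** (`Cruxes/AbsoluteUpgrade/STRATEGY-CENSUS.md` §2.3 / S2): relative
  Dickson–Hardy–Littlewood with Green–Tao's Conj. 1.4 error shape `ε(β_∞𝔖 + N)`, if it holds UNIFORMLY in the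
  number of forms `t ≤ (log log N)^A` (`UniformRelativeDimOne`, S⁺), implies the ABSOLUTE statement `DimOne`
  (Conj. 1.2 shape `εN` at `d = 1`), hence the crux `AbsoluteUpgrade`, the route's output node `RelativeDimOne`, and —
  through the proved fibration lemma (`summit_iff_dimOne`, p139053) — the sub-problem Statement
  `GeneralizedHardyLittlewood` itself (`generalizedHardyLittlewood_of_uniformRelativeDimOne`).

HONESTY.  S⁺ is not proved here and is at least as strong as the target stmt-Parity-0819 (it implies it, by this
file); the crux therefore stays open on exactly the residual `stub_uniformRelativeDimOne` of the skeleton.  What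
this file adds to the book is the mechanism: ANY proof of the relative conjecture whose constants are uniform in
`t ≤ (log log N)^{t₀}` forms discharges `AbsoluteUpgrade` for free, for both wanting routes
(route-Parity-LeeYangFibres, route-Parity-VarianceWitness).

References: P. X. Gallagher, Mathematika 23 (1976), §2 [Gallagher1976]; B. Green, T. Tao, Ann. of Math. 171
(2010), Conj. 1.2 / Conj. 1.4 and Lemma 1.3 [GreenTao2010]; T. Tao, V. Vu, *Additive Combinatorics*, §2.
-/

noncomputable section

namespace Summit.Parity.GeneralizedHardyLittlewood.Cruxes.AbsoluteUpgrade.UniformAmplification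

open Literature.NumberTheory.Sieve
open Summit.Parity.GeneralizedHardyLittlewood.Theses.LeeYangFibres (RelativeDimOne DimOne AbsoluteUpgrade)
open Summit.Parity.GeneralizedHardyLittlewood.Theorems.AbsoluteUpgrade (summit_iff_dimOne)

/-- **m-UNIFORM GALLAGHER AVERAGING (unconditional).** The main terms of the non-degenerate
translate-constellations of a one-dimensional system sum to `(β_∞ 𝔖)^{m+1}` up to
`ε((β_∞𝔖)^{m+1} + N^{m+1})`, uniformly in the number of translates `(m+1) t ≤ (log log N)^A`
(glue E applied to the landed stubs A, C, D1∘B, D2). [cite: Gallagher1976, Section 2] -/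
theorem uniformSingularMean : UniformSingularMean :=
  stub_uniformSingularMeanGlue stub_localRatioFacts stub_collisionFormFactsAndTail.1
    (stub_mediumCollisions stub_condLocalAverage) stub_collisionFormFactsAndTail.2

/-- **DOOR (b), PROVED: `t`-uniform relative Dickson–Hardy–Littlewood implies absolute
Dickson–Hardy–Littlewood at `d = 1`** (the registered sub-goal this file is filed under; the tensor-power
trick F fed with `uniformSingularMean` and the explicit degenerate count C(1)).
[cite: GreenTao2010, Conj. 1.2 and Conj. 1.4] -/
theorem dimOne_of_uniformRelativeDimOne : UniformRelativeDimOne → DimOne :=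
  fun h => stub_amplification uniformSingularMean stub_collisionFormFactsAndTail.1 h

/-- S⁺ discharges the crux `AbsoluteUpgrade := RelativeDimOne → DimOne` (its hypothesis unused — the census's
point: amplification converts `t`-uniformity, not `RelativeDimOne`, into the absolute statement). [folklore] -/
theorem absoluteUpgrade_of_uniformRelativeDimOne' : UniformRelativeDimOne → AbsoluteUpgrade :=
  fun h _ => dimOne_of_uniformRelativeDimOne h

/-- S⁺ is trivially at least the route's output node: `UniformRelativeDimOne → RelativeDimOne` (take `A = 1`,
the same `L`, and `N` so large that `t ≤ log log N`; `‖Ψ‖_N ≤ L ≤ L·t`). [cite: GreenTao2010, Conj. 1.4] -/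
theorem relativeDimOne_of_uniformRelativeDimOne : UniformRelativeDimOne → RelativeDimOne := by
  intro h t L ht ε hε
  obtain ⟨N₀, hN₀⟩ := h 1 L ε hε
  obtain ⟨N₁, hN₁⟩ := Filter.eventually_atTop.mp (eventually_le_loglog (t : ℝ))
  refine ⟨max N₀ N₁, fun N hN Ψ hΨ hL K hK hKN => ?_⟩
  have hN0 : N₀ ≤ N := le_trans (le_max_left _ _) hN
  have hN1 : N₁ ≤ N := le_trans (le_max_right _ _) hN
  have ht' : (t : ℝ) ≤ Real.log (Real.log N) ^ 1 := by
    rw [pow_one]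
    exact hN₁ N hN1
  have hL' : affLinSize Ψ N ≤ (L : ℝ) * t := by
    have ht1 : (1 : ℝ) ≤ t := by exact_mod_cast ht
    have hL0 : (0 : ℝ) ≤ L := Nat.cast_nonneg L
    calc affLinSize Ψ N ≤ L := hL
      _ = (L : ℝ) * 1 := (mul_one _).symm
      _ ≤ (L : ℝ) * t := mul_le_mul_of_nonneg_left ht1 hL0
  exact hN₀ N hN0 t ht ht' Ψ hΨ hL' K hK hKN

/-- **S⁺ implies the sub-problem Statement** `GeneralizedHardyLittlewood` (Green–Tao Conj. 1.2, all `d`,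
all complexities), through door (b) and the proved fibration lemma (`summit_iff_dimOne`).
[cite: GreenTao2010, Conj. 1.2 and the remark following it] -/
theorem generalizedHardyLittlewood_of_uniformRelativeDimOne :
    UniformRelativeDimOne → _root_.GeneralizedHardyLittlewood :=
  fun h => summit_iff_dimOne.mpr (dimOne_of_uniformRelativeDimOne h)

end Summit.Parity.GeneralizedHardyLittlewood.Cruxes.AbsoluteUpgrade.UniformAmplification

end
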